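import Literature.Topology.FourManifolds.SurfaceGroupNielsenDegreeForm
import HarnessLib

/-!
# Nielsen's lifting theorem after Zieschang: the mapping degree of an induced automorphism

Topic `Literature/Topology/FourManifolds`.  Pillar `(C1)` of the algebraic proof of Nielsen's
theorem (`SurfaceGroupNielsenSetup.lean`; ZVC LNM 835, 5.5.1–5.5.3 and the first half of the
proof of Thm. 5.6.1): for an endomorphism `Φ` of the free group `F = F⟨a, b⟩` inducing an
automorphism `α` of `S_g` (i.e. `proj ∘ Φ = α ∘ proj`), Zieschang's degree form
`θ = relatorDegree g` takes the value `±g` on `Φ(r_g)` (`degreeOfAut_holds : DegreeOfAut g`).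

The steps:

* `Φ` maps the relation subgroup `N̂ = ker proj` into itself (`map_mem_ker_of_induces`);
* **multiplicativity** (ZVC 5.5.2): `g · θ(Φ x) = θ(Φ r_g) · θ(x)` for `x ∈ N̂`
  (`relatorDegree_map_of_mem_ker`), by writing `x` as a signed product of conjugates of `r_g`;
* **identity-inducing endomorphisms have degree `g`** (ZVC 5.5.3): if `proj ∘ Γ = proj` then the
  pulled-back test vectors `pull Γ ξ₀ = ξ₀`, `pull Γ η₀ = η₀` (the additive characters kill `N̂`),
  so by naturality of the form on the balanced word `r_g`, `θ(Γ r_g) = θ(r_g) = g`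
  (`relatorDegree_map_surfaceRelator_of_induces_id`);
* every endomorphism `β` of `S_g` lifts to an endomorphism of `F` (`exists_endo_lift`);
* assembly: with `Ψ` a lift of `α⁻¹`, `Φ ∘ Ψ` induces the identity, so
  `g · g = θ(Φ r_g) · θ(Ψ r_g)`, both factors being multiples of `g`; hence `θ(Φ r_g) = ±g`.

## References

* H. Zieschang, E. Vogt, H.-D. Coldewey, *Surfaces and Planar Discontinuous Groups*, LNM 835,
  Springer (1980), §5.5 (5.5.1–5.5.3), §5.6 (proof of Thm. 5.6.1). [ZieschangVogtColdewey1980]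
* J. Nielsen, *Untersuchungen zur Topologie der geschlossenen zweiseitigen Flächen*, Acta Math.
  50 (1927) 189–358. [Nielsen1927]
-/

noncomputable section

namespace Literature.Topology.FourManifolds

open Literature.GroupTheory.CombinatorialGroupTheory List

namespace SurfaceGroup

variable {g : ℕ}

/-! ## Endomorphisms inducing endomorphisms of `S_g` preserve the relation subgroup -/

/-- The relator lies in the relation subgroup. [folklore] -/
theorem surfaceRelator_mem_ker_proj : surfaceRelator g ∈ (proj g).ker := by
  rw [MonoidHom.mem_ker]
  exact mk_surfaceRelator

/-- An endomorphism of the free group inducing an endomorphism of `S_g` maps the relation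
subgroup into itself. [cite: ZieschangVogtColdewey1980, 5.5.2] -/
theorem map_mem_ker_of_induces (β : SurfaceGroup g →* SurfaceGroup g)
    (Φ : FreeGroup (surfaceGen g) →* FreeGroup (surfaceGen g))
    (hΦ : ∀ x, proj g (Φ x) = β (proj g x)) {x : FreeGroup (surfaceGen g)}
    (hx : x ∈ (proj g).ker) : Φ x ∈ (proj g).ker := by
  rw [MonoidHom.mem_ker] at hx ⊢
  rw [hΦ, hx, map_one]

/-! ## The degree of inverses and signed powers on the relation subgroup -/

/-- On the relation subgroup the degree of an inverse is minus the degree. [folklore] -/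
theorem relatorDegree_inv_of_mem_ker {x : FreeGroup (surfaceGen g)} (hx : x ∈ (proj g).ker) :
    relatorDegree g x⁻¹ = -relatorDegree g x := by
  obtain ⟨ha, -⟩ := heisHom_ab_of_mem_ker (degXi g) (degEta g) hx
  unfold relatorDegree omega
  rw [map_inv, Heis.inv_c, ha, zero_mul, add_zero]

/-- On the relation subgroup the degree of `x^{ε}` is `ε` times the degree (`ε = ±1`).
[folklore] -/
theorem relatorDegree_zpow_bsign_of_mem_ker {x : FreeGroup (surfaceGen g)}
    (hx : x ∈ (proj g).ker) (s : Bool) :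
    relatorDegree g (x ^ bsign s) = bsign s * relatorDegree g x := by
  cases s
  · simp only [bsign, Bool.false_eq_true, ↓reduceIte, zpow_neg, zpow_one, neg_mul, one_mul]
    exact relatorDegree_inv_of_mem_ker hx
  · simp [bsign]

/-! ## Multiplicativity of the degree (ZVC 5.5.2) -/

/-- The degree of the image of a signed product of conjugates under an endomorphism inducing an
endomorphism of `S_g`: `θ(Φ(∏ Kⱼ r^{εⱼ} Kⱼ⁻¹)) = θ(Φ r) · ∑ εⱼ`.
[cite: ZieschangVogtColdewey1980, 5.5.2] -/
theorem relatorDegree_map_conjProd (β : SurfaceGroup g →* SurfaceGroup g)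
    (Φ : FreeGroup (surfaceGen g) →* FreeGroup (surfaceGen g))
    (hΦ : ∀ x, proj g (Φ x) = β (proj g x)) (L : List (FreeGroup (surfaceGen g) × Bool)) :
    relatorDegree g (Φ (conjProd L)) = relatorDegree g (Φ (surfaceRelator g)) * signSum L := by
  have hΦr : Φ (surfaceRelator g) ∈ (proj g).ker :=
    map_mem_ker_of_induces β Φ hΦ surfaceRelator_mem_ker_proj
  induction L with
  | nil => simp [conjProd, signSum, relatorDegree, omega]
  | cons p L ih =>
    rw [conjProd_cons, signSum_cons, map_mul]
    have hmem : p.1 * surfaceRelator g ^ bsign p.2 * p.1⁻¹ ∈ (proj g).ker := by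
      rw [MonoidHom.mem_ker, map_mul, map_mul, map_zpow, mk_surfaceRelator, one_zpow, mul_one,
        ← map_mul, mul_inv_cancel, map_one]
    have hzr : Φ (surfaceRelator g) ^ bsign p.2 ∈ (proj g).ker := Subgroup.zpow_mem _ hΦr _
    rw [relatorDegree_mul_of_mem_ker (map_mem_ker_of_induces β Φ hΦ hmem), ih, map_mul, map_mul,
      map_inv, map_zpow, relatorDegree_conj_of_mem_ker _ hzr,
      relatorDegree_zpow_bsign_of_mem_ker hΦr]
    ring

/-- **Multiplicativity of the degree** (ZVC 5.5.2): for an endomorphism `Φ` of the free group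
inducing an endomorphism of `S_g` and `x` in the relation subgroup,
`g · θ(Φ x) = θ(Φ r_g) · θ(x)` — i.e. `θ(Φ x)/g = (θ(Φ r_g)/g) · (θ(x)/g)`, the degree of `Φ` being
`θ(Φ r_g)/g`. [cite: ZieschangVogtColdewey1980, 5.5.2] -/
theorem relatorDegree_map_of_mem_ker (β : SurfaceGroup g →* SurfaceGroup g)
    (Φ : FreeGroup (surfaceGen g) →* FreeGroup (surfaceGen g))
    (hΦ : ∀ x, proj g (Φ x) = β (proj g x)) {x : FreeGroup (surfaceGen g)}
    (hx : x ∈ (proj g).ker) :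
    (g : ℤ) * relatorDegree g (Φ x) = relatorDegree g (Φ (surfaceRelator g)) * relatorDegree g x := by
  obtain ⟨L, rfl⟩ := exists_conjProd_of_mem_ker hx
  rw [relatorDegree_conjProd, relatorDegree_map_conjProd β Φ hΦ]
  ring

/-! ## Identity-inducing endomorphisms have degree `g` (ZVC 5.5.3) -/

/-- The additive characters of the free group kill the relation subgroup (the relator is a
product of commutators). [folklore] -/
theorem achar_eq_one_of_mem_ker (ξ : surfaceGen g → ℤ) {x : FreeGroup (surfaceGen g)}
    (hx : x ∈ (proj g).ker) : achar ξ x = 1 := by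
  rw [mem_ker_proj_iff] at hx
  have h : Subgroup.normalClosure ({surfaceRelator g} : Set (FreeGroup (surfaceGen g))) ≤
      (achar ξ).ker := by
    refine Subgroup.normalClosure_le_normal ?_
    intro y hy
    rw [Set.mem_singleton_iff] at hy
    subst hy
    rw [SetLike.mem_coe, MonoidHom.mem_ker]
    exact lift_surfaceRelator_eq_one_of_comm _
  exact (MonoidHom.mem_ker).1 (h hx)

/-- An identity-inducing endomorphism does not change the additive characters. [folklore] -/
theorem achar_map_of_induces_id (ξ : surfaceGen g → ℤ)
    (Γ : FreeGroup (surfaceGen g) →* FreeGroup (surfaceGen g)) (hΓ : ∀ x, proj g (Γ x) = proj g x)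
    (x : FreeGroup (surfaceGen g)) : achar ξ (Γ x) = achar ξ x := by
  have hmem : x⁻¹ * Γ x ∈ (proj g).ker := by
    rw [MonoidHom.mem_ker, map_mul, hΓ, ← map_mul, inv_mul_cancel, map_one]
  have h := achar_eq_one_of_mem_ker ξ hmem
  rw [map_mul, map_inv, inv_mul_eq_one] at h
  exact h.symm

/-- An identity-inducing endomorphism does not change the pulled-back weights:
`pull Γ ξ = ξ`. [cite: ZieschangVogtColdewey1980, 5.5.3] -/
theorem pull_eq_of_induces_id (Γ : FreeGroup (surfaceGen g) →* FreeGroup (surfaceGen g))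
    (hΓ : ∀ x, proj g (Γ x) = proj g x) (ξ : surfaceGen g → ℤ) : pull Γ ξ = ξ := by
  funext i
  simp only [pull]
  rw [lsum_toWord, achar_map_of_induces_id ξ Γ hΓ, achar, FreeGroup.lift_apply_of, toAdd_ofAdd]

/-- **Identity-inducing endomorphisms have degree `g`** (ZVC Lemma 5.5.3): if `proj ∘ Γ = proj`
then `θ(Γ r_g) = g`. [cite: ZieschangVogtColdewey1980, 5.5.3] -/
theorem relatorDegree_map_surfaceRelator_of_induces_id
    (Γ : FreeGroup (surfaceGen g) →* FreeGroup (surfaceGen g)) (hΓ : ∀ x, proj g (Γ x) = proj g x) :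
    relatorDegree g (Γ (surfaceRelator g)) = g := by
  have h : relatorDegree g (Γ (surfaceRelator g)) = relatorDegree g (surfaceRelator g) := by
    unfold relatorDegree
    rw [← mk_surfaceWordStd,
      omega_map_mk_of_balanced _ _ _ (isQuadratic_surfaceWordStd g).isBalanced,
      pull_eq_of_induces_id Γ hΓ, pull_eq_of_induces_id Γ hΓ]
  rw [h, relatorDegree_surfaceRelator]

/-! ## Lifting endomorphisms of `S_g` to the free group -/

/-- Every endomorphism of `S_g` lifts to an endomorphism of the free group (lift the images of
the generators). [folklore] -/
theorem exists_endo_lift (β : SurfaceGroup g →* SurfaceGroup g) :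
    ∃ Ψ : FreeGroup (surfaceGen g) →* FreeGroup (surfaceGen g), ∀ x, proj g (Ψ x) = β (proj g x) := by
  classical
  let X : surfaceGen g → FreeGroup (surfaceGen g) := fun i =>
    Classical.choose (PresentedGroup.mk_surjective ({surfaceRelator g} : Set (FreeGroup (surfaceGen g)))
      (β (PresentedGroup.of i)))
  have hX : ∀ i, proj g (X i) = β (PresentedGroup.of i) := fun i =>
    Classical.choose_spec (PresentedGroup.mk_surjective
      ({surfaceRelator g} : Set (FreeGroup (surfaceGen g))) (β (PresentedGroup.of i)))
  refine ⟨FreeGroup.lift X, ?_⟩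
  have key : (proj g).comp (FreeGroup.lift X) = β.comp (proj g) := by
    refine FreeGroup.ext_hom _ _ fun i => ?_
    simp only [MonoidHom.coe_comp, Function.comp_apply, FreeGroup.lift_apply_of]
    exact hX i
  intro x
  exact DFunLike.congr_fun key x

/-! ## Assembly: the degree of an induced automorphism is `±1` -/

/-- **(C1) Mapping degree** (ZVC 5.5.2, 5.5.3 and the first half of the proof of Thm. 5.6.1): an
endomorphism `Φ` of the free group inducing an automorphism of `S_g` has `θ(Φ r_g) = ±g`.
[cite: ZieschangVogtColdewey1980, 5.5.2, 5.5.3, Thm. 5.6.1] -/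
theorem degreeOfAut_holds (g : ℕ) : DegreeOfAut g := by
  intro α Φ hΦ
  obtain ⟨Ψ, hΨ⟩ := exists_endo_lift (g := g) α.symm.toMonoidHom
  -- `Γ := Φ ∘ Ψ` induces the identity of `S_g`
  have hΓ : ∀ x, proj g ((Φ.comp Ψ) x) = proj g x := by
    intro x
    rw [MonoidHom.comp_apply, hΦ, hΨ, MulEquiv.coe_toMonoidHom, MulEquiv.apply_symm_apply]
  have h3 := relatorDegree_map_surfaceRelator_of_induces_id _ hΓ
  rw [MonoidHom.comp_apply] at h3
  have hΨr : Ψ (surfaceRelator g) ∈ (proj g).ker :=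
    map_mem_ker_of_induces _ Ψ hΨ surfaceRelator_mem_ker_proj
  have hΦ' : ∀ x, proj g (Φ x) = α.toMonoidHom (proj g x) := fun x => by
    rw [hΦ, MulEquiv.coe_toMonoidHom]
  have h2 := relatorDegree_map_of_mem_ker α.toMonoidHom Φ hΦ' hΨr
  rw [h3] at h2
  obtain ⟨L, hL⟩ := exists_conjProd_of_mem_ker
    (map_mem_ker_of_induces α.toMonoidHom Φ hΦ' surfaceRelator_mem_ker_proj)
  obtain ⟨L', hL'⟩ := exists_conjProd_of_mem_ker hΨr
  have hd : relatorDegree g (Φ (surfaceRelator g)) = g * signSum L := by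
    rw [hL, relatorDegree_conjProd]
  have hd' : relatorDegree g (Ψ (surfaceRelator g)) = g * signSum L' := by
    rw [hL', relatorDegree_conjProd]
  rw [hd, hd'] at h2
  rw [hd]
  rcases Nat.eq_zero_or_pos g with hg | hg
  · left
    subst hg
    simp
  · have hg' : (g : ℤ) ≠ 0 := by exact_mod_cast hg.ne'
    have hss : signSum L * signSum L' = 1 := by
      have h' : (g : ℤ) * g * (signSum L * signSum L') = g * g * 1 := by
        rw [mul_one]
        linear_combination -h2
      exact mul_left_cancel₀ (mul_ne_zero hg' hg') h'
    rcases Int.eq_one_or_neg_one_of_mul_eq_one hss with h | h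
    · left
      rw [h, mul_one]
    · right
      rw [h, mul_neg, mul_one]

end SurfaceGroup

end Literature.Topology.FourManifolds

end
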